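import Mathlib
import HarnessLib.Audit
import Summits.PneNP.PneNP.Theorems.PstarGConstraint

/-!
# The one-block coincidence table: local second readers against `s·(p ⊕ q)` (ROUND-24, O1; memo g26 §66)

FRONTIER range-avoidance ladder, rung F-N3, ROUND 24 (cell `pnp-ideate`, prover-2 memo `g26/O1-LOCALITY-g26.md` §66; census node
`PstarSharpGateBudgetAssembly.SharpMenuCriterionBoundGateBudget`, branch (B) = `PstarCoincidenceExact.NoCoincidenceExact`; restricted-model proof
complexity — nothing here bears on `P` versus `NP`).

By `PstarCoincidenceLocality` / `PstarLocalCriterion.coincidence_trunc` an exact coincidence on the fold set `F₁` only depends on the part of the second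
reader living on the AND variables of `F₁`.  The basic shape of the census (p3 memo §14.62–14.63: the pendant partner `o = (v, ℓ)` sharing its
literal `s` with the core member `t`, chords `(v', ℓ)` closing the path) is `F₁ = {t, o}` with AND pairs `(s, p)` and `(s, q)`:
`R₁ = x_s x_p ⊕ x_s x_q = x_s (x_p ⊕ x_q)`.  A LOCAL second reader is then `(C₂ ⊆ {s, p, q}, G₂ ⊆ {t, o, g})` with `g` the (possible) output of AND
pair `{p, q}`.  This file computes the whole table, kernel-checked:

* `gval_pair_eq`, `gval_local_eq` — both readers as explicit Boolean functions of `(x_s, x_p, x_q)`;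
* **`coincidence_iff`** — `R₁ = β₁ ∧ R₂ = β₂` is unsatisfiable iff the finite condition `Unsat β₁ β₂ [s∈C₂] [p∈C₂] [q∈C₂] [t∈G₂] [o∈G₂] [g∈G₂]` holds;
* **`unsat_true_iff`** — for `β₁ = 1` (the slice value that pins `s = 1`, `p ≠ q`): unsatisfiable iff `[p∈C₂] ⊕ [q∈C₂] ⊕ [t∈G₂] ⊕ [o∈G₂] = 0` (and `β₂`
  is the complementary value) — e.g. `R₂ = x_s`, `R₂ = x_p ⊕ x_q` (menu `∅`), `R₂ = x_s x_p ⊕ x_p`, …;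
* **`unsat_false_iff`** — for `β₁ = 0`: unsatisfiable iff the local reader is `0` or `R₁` itself with target `1` (the degenerate readers the node's
  essentiality clause excludes) — NO genuine coincidence.

So on this shape the `∅`-channel (linear readers `x_s`, `x_p ⊕ x_q`, `x_s ⊕ x_p ⊕ x_q`) already certifies, menus add nothing new, and only the
slice value `β₁ = 1` is vulnerable — the kernel form of the census's "one-block value-1 arc" entries, for all `k`.
-/

set_option linter.dupNamespace false -- `Summit.PneNP.PneNP.…`: summit = sub-problem name (D-0017 single-conjunct layout)

open Finset Literature.Computability.Complexity
open Summit.PneNP.PneNP.Theorems.PstarFibrePolys (bit bit_xor bit_and bit_injective)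
open Summit.PneNP.PneNP.Theorems.PstarGapOneAll (gval)
open Summit.PneNP.PneNP.Theorems.PstarGConstraint (bit_gval)

namespace Summit.PneNP.PneNP.Theorems.PstarPendantCoincidence

variable {n m : ℕ}

/-! ## The finite table -/

/-- The local second reader as a Boolean function of `(a, b, c) = (x_s, x_p, x_q)`, given the membership bits
`S = [s ∈ C₂], P = [p ∈ C₂], Q = [q ∈ C₂], T = [t ∈ G₂], O = [o ∈ G₂], Gg = [g ∈ G₂]`. -/
def localVal (S P Q T O Gg a b c : Bool) : Bool :=
  xor (xor (xor (S && a) (P && b)) (xor (Q && c) (T && (a && b)))) (xor (O && (a && c)) (Gg && (b && c)))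

/-- The finite unsatisfiability condition: no `(a, b, c)` with `a·(b ⊕ c) = β₁` and `localVal = β₂`. -/
def Unsat (β₁ β₂ S P Q T O Gg : Bool) : Prop := ∀ a b c : Bool, (a && xor b c) = β₁ → localVal S P Q T O Gg a b c ≠ β₂

/-- **Slice value `1`: the parity rule.**  Unsatisfiable iff `P ⊕ Q ⊕ T ⊕ O = 0`, with `β₂` the complement of the (then constant) value at `(1,0,1)`. -/
theorem unsat_true_iff (β₂ S P Q T O Gg : Bool) :
    Unsat true β₂ S P Q T O Gg ↔ xor (xor P Q) (xor T O) = false ∧ β₂ = !(localVal S P Q T O Gg true false true) := by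
  unfold Unsat localVal
  cases β₂ <;> cases S <;> cases P <;> revert Q T O Gg <;> decide

/-- **Slice value `0`: only degenerate readers.**  Unsatisfiable iff the local reader is `0` (`S = P = Q = T = O = Gg = 0`) or `R₁` itself
(`T = O = 1`, rest `0`), in both cases with target `β₂ = 1`. -/
theorem unsat_false_iff (β₂ S P Q T O Gg : Bool) :
    Unsat false β₂ S P Q T O Gg ↔ S = false ∧ P = false ∧ Q = false ∧ Gg = false ∧ T = O ∧ β₂ = true := by
  unfold Unsat localVal
  cases β₂ <;> cases S <;> cases P <;> revert Q T O Gg <;> decide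

/-! ## The readers on an instance -/
section Instance

variable (I : LocalMap 4 n m) {t o g : Fin m} {s p q : Fin n}

/-- In `𝔽₂`: `bit (a·(b ⊕ c)) = bit a · bit b + bit a · bit c`. -/
private theorem bit_pair (a b c : Bool) : bit (a && xor b c) = bit a * bit b + bit a * bit c := by
  cases a <;> cases b <;> cases c <;> decide

/-- In `𝔽₂`: an indicator times a bit. -/
private theorem ite_mul_eq (P : Prop) [Decidable P] (x : Bool) : (if P then bit x else 0) = bit (decide P && x) := by
  by_cases h : P <;> cases x <;> simp [h, bit]

/-- **The first reader**: `gval ∅ {t, o} = x_s·(x_p ⊕ x_q)` when `t, o` have AND pairs `(s, p)`, `(s, q)`. -/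
theorem gval_pair_eq (hto : t ≠ o) (ht2 : I.vars t 2 = s) (ht3 : I.vars t 3 = p) (ho2 : I.vars o 2 = s) (ho3 : I.vars o 3 = q)
    (z : Fin n → Bool) : gval I ∅ {t, o} z = (z s && xor (z p) (z q)) := by
  classical
  apply bit_injective
  rw [bit_gval, sum_empty, zero_add, sum_pair hto, ht2, ht3, ho2, ho3, bit_pair]

/-- **The local second reader**: for `C₂ ⊆ {s, p, q}` and `G₂ ⊆ {t, o, g}` (`g` of AND pair `{p, q}`), `gval C₂ G₂` is `localVal` of the membership bits. -/
theorem gval_local_eq (hsp : s ≠ p) (hsq : s ≠ q) (hpq : p ≠ q) (hto : t ≠ o) (htg : t ≠ g) (hog : o ≠ g)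
    (ht2 : I.vars t 2 = s) (ht3 : I.vars t 3 = p) (ho2 : I.vars o 2 = s) (ho3 : I.vars o 3 = q)
    (hg : (I.vars g 2 = p ∧ I.vars g 3 = q) ∨ (I.vars g 2 = q ∧ I.vars g 3 = p))
    {C₂ : Finset (Fin n)} (hC : C₂ ⊆ {s, p, q}) {G₂ : Finset (Fin m)} (hG : G₂ ⊆ {t, o, g}) (z : Fin n → Bool) :
    gval I C₂ G₂ z = localVal (decide (s ∈ C₂)) (decide (p ∈ C₂)) (decide (q ∈ C₂)) (decide (t ∈ G₂)) (decide (o ∈ G₂)) (decide (g ∈ G₂))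
      (z s) (z p) (z q) := by
  classical
  apply bit_injective
  rw [bit_gval]
  -- linear part over `{s, p, q}`
  have hlin : ∑ v ∈ C₂, bit (z v) = ∑ v ∈ ({s, p, q} : Finset (Fin n)), (if v ∈ C₂ then bit (z v) else 0) := by
    rw [← sum_filter]
    exact sum_congr (by ext v; rw [mem_filter]; exact ⟨fun h => ⟨hC h, h⟩, fun h => h.2⟩) fun _ _ => rfl
  have hmon : ∑ j ∈ G₂, bit (z (I.vars j 2)) * bit (z (I.vars j 3)) =
      ∑ j ∈ ({t, o, g} : Finset (Fin m)), (if j ∈ G₂ then bit (z (I.vars j 2)) * bit (z (I.vars j 3)) else 0) := by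
    rw [← sum_filter]
    exact sum_congr (by ext j; rw [mem_filter]; exact ⟨fun h => ⟨hG h, h⟩, fun h => h.2⟩) fun _ _ => rfl
  have hs' : s ∉ ({p, q} : Finset (Fin n)) := by simp [hsp, hsq]
  have hp' : p ∉ ({q} : Finset (Fin n)) := by simp [hpq]
  have ht' : t ∉ ({o, g} : Finset (Fin m)) := by simp [hto, htg]
  have ho' : o ∉ ({g} : Finset (Fin m)) := by simp [hog]
  have hgm : bit (z (I.vars g 2)) * bit (z (I.vars g 3)) = bit (z p) * bit (z q) := by
    rcases hg with ⟨h2, h3⟩ | ⟨h2, h3⟩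
    · rw [h2, h3]
    · rw [h2, h3, mul_comm]
  rw [hlin, hmon, sum_insert hs', sum_insert hp', sum_singleton, sum_insert ht', sum_insert ho', sum_singleton, ht2, ht3, ho2, ho3, hgm]
  have e1 : (if t ∈ G₂ then bit (z s) * bit (z p) else 0) = bit (decide (t ∈ G₂)) * (bit (z s) * bit (z p)) := by
    by_cases h : t ∈ G₂ <;> simp [h, bit]
  have e2 : (if o ∈ G₂ then bit (z s) * bit (z q) else 0) = bit (decide (o ∈ G₂)) * (bit (z s) * bit (z q)) := by
    by_cases h : o ∈ G₂ <;> simp [h, bit]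
  have e3 : (if g ∈ G₂ then bit (z p) * bit (z q) else 0) = bit (decide (g ∈ G₂)) * (bit (z p) * bit (z q)) := by
    by_cases h : g ∈ G₂ <;> simp [h, bit]
  rw [ite_mul_eq, ite_mul_eq, ite_mul_eq, e1, e2, e3]
  unfold localVal
  simp only [bit_xor, bit_and]
  ring

/-- **THE ONE-BLOCK COINCIDENCE TABLE.**  With `F₁ = {t, o}` as above and a local second reader `(C₂ ⊆ {s,p,q}, G₂ ⊆ {t,o,g})`:
`R₁ = β₁ ∧ R₂ = β₂` is unsatisfiable over all assignments iff the finite condition `Unsat` holds for the membership bits. -/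
theorem coincidence_iff (hsp : s ≠ p) (hsq : s ≠ q) (hpq : p ≠ q) (hto : t ≠ o) (htg : t ≠ g) (hog : o ≠ g)
    (ht2 : I.vars t 2 = s) (ht3 : I.vars t 3 = p) (ho2 : I.vars o 2 = s) (ho3 : I.vars o 3 = q)
    (hg : (I.vars g 2 = p ∧ I.vars g 3 = q) ∨ (I.vars g 2 = q ∧ I.vars g 3 = p))
    {C₂ : Finset (Fin n)} (hC : C₂ ⊆ {s, p, q}) {G₂ : Finset (Fin m)} (hG : G₂ ⊆ {t, o, g}) (β₁ β₂ : Bool) :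
    (∀ z : Fin n → Bool, ¬ (gval I ∅ {t, o} z = β₁ ∧ gval I C₂ G₂ z = β₂)) ↔
      Unsat β₁ β₂ (decide (s ∈ C₂)) (decide (p ∈ C₂)) (decide (q ∈ C₂)) (decide (t ∈ G₂)) (decide (o ∈ G₂)) (decide (g ∈ G₂)) := by
  constructor
  · intro h a b c habc hval
    -- the point with `(x_s, x_p, x_q) = (a, b, c)`
    set z : Fin n → Bool := Function.update (Function.update (Function.update (fun _ => false) s a) p b) q c with hz
    have hzs : z s = a := by rw [hz, Function.update_of_ne hsq, Function.update_of_ne hsp, Function.update_self]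
    have hzp : z p = b := by rw [hz, Function.update_of_ne hpq, Function.update_self]
    have hzq : z q = c := by rw [hz, Function.update_self]
    refine h z ⟨?_, ?_⟩
    · rw [gval_pair_eq I hto ht2 ht3 ho2 ho3, hzs, hzp, hzq]; exact habc
    · rw [gval_local_eq I hsp hsq hpq hto htg hog ht2 ht3 ho2 ho3 hg hC hG, hzs, hzp, hzq]; exact hval
  · rintro h z ⟨h1, h2⟩
    rw [gval_pair_eq I hto ht2 ht3 ho2 ho3] at h1
    rw [gval_local_eq I hsp hsq hpq hto htg hog ht2 ht3 ho2 ho3 hg hC hG] at h2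
    exact h _ _ _ h1 h2

/-- **Corollary: at slice value `0` there is no genuine coincidence** — a local reader with a linear read, or with the `pq`-gate, or with exactly
one of the folds, is jointly satisfiable with `R₁ = 0`. -/
theorem satisfiable_of_slice_false (hsp : s ≠ p) (hsq : s ≠ q) (hpq : p ≠ q) (hto : t ≠ o) (htg : t ≠ g) (hog : o ≠ g)
    (ht2 : I.vars t 2 = s) (ht3 : I.vars t 3 = p) (ho2 : I.vars o 2 = s) (ho3 : I.vars o 3 = q)
    (hg : (I.vars g 2 = p ∧ I.vars g 3 = q) ∨ (I.vars g 2 = q ∧ I.vars g 3 = p))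
    {C₂ : Finset (Fin n)} (hC : C₂ ⊆ {s, p, q}) {G₂ : Finset (Fin m)} (hG : G₂ ⊆ {t, o, g}) (β₂ : Bool)
    (hnondeg : C₂.Nonempty ∨ g ∈ G₂ ∨ ¬ (t ∈ G₂ ↔ o ∈ G₂)) : ∃ z : Fin n → Bool, gval I ∅ {t, o} z = false ∧ gval I C₂ G₂ z = β₂ := by
  by_contra hne
  push Not at hne
  have h := (coincidence_iff I hsp hsq hpq hto htg hog ht2 ht3 ho2 ho3 hg hC hG false β₂).1 fun z ⟨h1, h2⟩ => hne z h1 h2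
  rw [unsat_false_iff] at h
  obtain ⟨hS, hP, hQ, hGg, hTO, -⟩ := h
  rcases hnondeg with ⟨v, hv⟩ | hgG | hTO'
  · have hv' := hC hv
    simp only [mem_insert, mem_singleton] at hv'
    rcases hv' with rfl | rfl | rfl
    · exact absurd hv (by simpa using hS)
    · exact absurd hv (by simpa using hP)
    · exact absurd hv (by simpa using hQ)
  · exact absurd hgG (by simpa using hGg)
  · exact hTO' (by simpa using hTO)

/-- **Corollary: at slice value `1` the `∅`-menu linear reader `x_s` is a coincidence** (target `0`) — the pendant chord fails the `∅` channel. -/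
theorem coincidence_literal (hsp : s ≠ p) (hsq : s ≠ q) (hpq : p ≠ q) (hto : t ≠ o) (htg : t ≠ g) (hog : o ≠ g)
    (ht2 : I.vars t 2 = s) (ht3 : I.vars t 3 = p) (ho2 : I.vars o 2 = s) (ho3 : I.vars o 3 = q)
    (hg : (I.vars g 2 = p ∧ I.vars g 3 = q) ∨ (I.vars g 2 = q ∧ I.vars g 3 = p)) :
    ∀ z : Fin n → Bool, ¬ (gval I ∅ {t, o} z = true ∧ gval I {s} ∅ z = false) := by
  have hC : ({s} : Finset (Fin n)) ⊆ {s, p, q} := by simp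
  have hG : (∅ : Finset (Fin m)) ⊆ {t, o, g} := empty_subset _
  rw [coincidence_iff I hsp hsq hpq hto htg hog ht2 ht3 ho2 ho3 hg hC hG, unsat_true_iff]
  simp [localVal, hsp.symm, hsq.symm]

end Instance

end Summit.PneNP.PneNP.Theorems.PstarPendantCoincidence
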